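import Mathlib
import Summits.ValiantsHypothesis.ValiantsHypothesis.Theses.PartialSorting

/-!
# PartialSorting — `SmoothIsBoard`, part 2: counting with the north-east rank function

Helper file for item stmt-ValiantsHypothesis-13597 (`SmoothIsBoard`, route PartialSorting).
The route decl compares permutations `σ, w ∈ S_n` by the Björner–Brenti rank criterion
(BjornerBrenti2005 Thm 2.1.5): `σ ≤ w` iff `σ[i,j] ≤ w[i,j]` for all `i, j`, where
`p[i,j] = #{a ≤ i : j ≤ p a}` is the number of rooks of `p` weakly north-east of the square
`(i, j)` (rows `a`, columns `p a`).  We keep this quantity *inlined* as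
`(Finset.univ.filter (fun a => a ≤ i ∧ j ≤ p a)).card` (no new definitions) and prove:

* elementary counting identities for it (row / column steps, boundary values, the
  complementary south-west count);
* `ne_witness`, `sw_witness`: the easy direction of Sjöstrand's theorem
  (doi:10.1016/j.jcta.2007.01.001, Thm 3.1): `σ ≤ w ⇒` every rook `(a, σ a)` of `σ` lies in the
  right hull of `w` (a rook of `w` weakly north-east and one weakly south-west of it).

Sjöstrand's essential-square argument and the final assembly are in
`PartialSortingSmoothIsBoard.lean`.
-/

-- `Summit.ValiantsHypothesis.ValiantsHypothesis.…` is the tree's mandated single-conjunct layout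
-- (Sub = Summit), so the duplicated namespace component is intended.
set_option linter.dupNamespace false

namespace Summit.ValiantsHypothesis.ValiantsHypothesis.Theorems.PartialSortingSmoothIsBoardRank

open Finset

variable {n : ℕ}

/-! ## Counting -/

/-- Splitting a filtered cardinality along a second predicate. -/
theorem card_filter_split {α : Type*} (s : Finset α) (p q : α → Prop) [DecidablePred p]
    [DecidablePred q] :
    (s.filter p).card =
      (s.filter (fun a => p a ∧ q a)).card + (s.filter (fun a => p a ∧ ¬ q a)).card := by
  rw [← card_filter_add_card_filter_not (s := s.filter p) q, filter_filter, filter_filter]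

/-- For a permutation `f` of `Fin n`, exactly `n - j` rows carry a value `≥ j`. -/
theorem card_filter_le_perm (f : Equiv.Perm (Fin n)) (j : Fin n) :
    (univ.filter (fun a => j ≤ f a)).card = n - j := by
  have h : univ.filter (fun a => j ≤ f a) =
      (univ.filter (fun b : Fin n => j ≤ b)).map f.symm.toEmbedding := by
    ext a
    simp only [mem_filter, mem_univ, true_and, mem_map_equiv, Equiv.symm_symm]
  rw [h, card_map, filter_le_eq_Ici, Fin.card_Ici]

/-- For a permutation `f` of `Fin n`, exactly `j` rows carry a value `< j`. -/
theorem card_filter_lt_perm (f : Equiv.Perm (Fin n)) (j : Fin n) :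
    (univ.filter (fun a => f a < j)).card = j := by
  have h : univ.filter (fun a => f a < j) =
      (univ.filter (fun b : Fin n => b < j)).map f.symm.toEmbedding := by
    ext a
    simp only [mem_filter, mem_univ, true_and, mem_map_equiv, Equiv.symm_symm]
  rw [h, card_map, filter_gt_eq_Iio, Fin.card_Iio]

/-- The rows `≤ i` number `i + 1`. -/
theorem card_filter_le_row (i : Fin n) : (univ.filter (fun a : Fin n => a ≤ i)).card = i + 1 := by
  rw [filter_ge_eq_Iic, Fin.card_Iic]

/-- `p[i,j] ≤ i + 1`. -/
theorem ne_le_row (f : Fin n → Fin n) (i j : Fin n) :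
    (univ.filter (fun a => a ≤ i ∧ j ≤ f a)).card ≤ i + 1 := by
  calc (univ.filter (fun a => a ≤ i ∧ j ≤ f a)).card
      ≤ (univ.filter (fun a : Fin n => a ≤ i)).card :=
        card_le_card (fun a ha => by
          simp only [mem_filter, mem_univ, true_and] at ha ⊢
          exact ha.1)
    _ = i + 1 := card_filter_le_row i

/-- `p[i,j] ≤ n - j` for a permutation `p`. -/
theorem ne_le_col (f : Equiv.Perm (Fin n)) (i j : Fin n) :
    (univ.filter (fun a => a ≤ i ∧ j ≤ f a)).card ≤ n - j := by
  calc (univ.filter (fun a => a ≤ i ∧ j ≤ f a)).card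
      ≤ (univ.filter (fun a => j ≤ f a)).card :=
        card_le_card (fun a ha => by
          simp only [mem_filter, mem_univ, true_and] at ha ⊢
          exact ha.2)
    _ = n - j := card_filter_le_perm f j

/-- Last row: `p[n-1, j] = n - j` for a permutation `p`. -/
theorem ne_last_row (f : Equiv.Perm (Fin n)) (i j : Fin n) (hi : n ≤ (i : ℕ) + 1) :
    (univ.filter (fun a => a ≤ i ∧ j ≤ f a)).card = n - j := by
  have h : univ.filter (fun a => a ≤ i ∧ j ≤ f a) = univ.filter (fun a => j ≤ f a) := by
    ext a
    simp only [mem_filter, mem_univ, true_and]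
    constructor
    · exact fun h => h.2
    · exact fun h => ⟨by omega, h⟩
  rw [h, card_filter_le_perm]

/-- First column: `p[i, 0] = i + 1`. -/
theorem ne_first_col (f : Fin n → Fin n) (i j : Fin n) (hj : (j : ℕ) = 0) :
    (univ.filter (fun a => a ≤ i ∧ j ≤ f a)).card = i + 1 := by
  have h : univ.filter (fun a => a ≤ i ∧ j ≤ f a) = univ.filter (fun a => a ≤ i) := by
    ext a
    simp only [mem_filter, mem_univ, true_and]
    constructor
    · exact fun h => h.1
    · exact fun h => ⟨h, by omega⟩
  rw [h, card_filter_le_row]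

/-- Row step: `p[i+1, j] = p[i, j] + [j ≤ p (i+1)]`. -/
theorem ne_row_succ (f : Fin n → Fin n) (i i1 j : Fin n) (h : (i1 : ℕ) = i + 1) :
    (univ.filter (fun a => a ≤ i1 ∧ j ≤ f a)).card =
      (univ.filter (fun a => a ≤ i ∧ j ≤ f a)).card + (if j ≤ f i1 then 1 else 0) := by
  have hsplit : univ.filter (fun a => a ≤ i1 ∧ j ≤ f a) =
      univ.filter (fun a => a ≤ i ∧ j ≤ f a) ∪ univ.filter (fun a => a = i1 ∧ j ≤ f a) := by
    ext a
    simp only [mem_filter, mem_univ, true_and, mem_union]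
    constructor
    · rintro ⟨h1, h2⟩
      by_cases ha : a = i1
      · exact Or.inr ⟨ha, h2⟩
      · exact Or.inl ⟨by omega, h2⟩
    · rintro (⟨h1, h2⟩ | ⟨h1, h2⟩)
      · exact ⟨by omega, h2⟩
      · exact ⟨by omega, h2⟩
  have hdisj : Disjoint (univ.filter (fun a => a ≤ i ∧ j ≤ f a))
      (univ.filter (fun a => a = i1 ∧ j ≤ f a)) := by
    rw [disjoint_filter]
    intro a _ h1 h2
    omega
  rw [hsplit, card_union_of_disjoint hdisj]
  congr 1
  by_cases hj : j ≤ f i1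
  · rw [if_pos hj]
    have he : univ.filter (fun a => a = i1 ∧ j ≤ f a) = {i1} := by
      ext a
      simp only [mem_filter, mem_univ, true_and, mem_singleton]
      constructor
      · exact fun h' => h'.1
      · intro h'
        subst h'
        exact ⟨rfl, hj⟩
    rw [he, card_singleton]
  · rw [if_neg hj]
    have he : univ.filter (fun a => a = i1 ∧ j ≤ f a) = ∅ := by
      ext a
      simp only [mem_filter, mem_univ, true_and, notMem_empty, iff_false, not_and]
      intro h'
      subst h'
      exact hj
    rw [he, card_empty]

/-- Column step: `p[i, j] = p[i, j+1] + #{a ≤ i : p a = j}`. -/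
theorem ne_col_succ (f : Fin n → Fin n) (i j j1 : Fin n) (h : (j1 : ℕ) = j + 1) :
    (univ.filter (fun a => a ≤ i ∧ j ≤ f a)).card =
      (univ.filter (fun a => a ≤ i ∧ j1 ≤ f a)).card +
        (univ.filter (fun a => a ≤ i ∧ f a = j)).card := by
  have hsplit : univ.filter (fun a => a ≤ i ∧ j ≤ f a) =
      univ.filter (fun a => a ≤ i ∧ j1 ≤ f a) ∪ univ.filter (fun a => a ≤ i ∧ f a = j) := by
    ext a
    simp only [mem_filter, mem_univ, true_and, mem_union]
    constructor
    · rintro ⟨h1, h2⟩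
      by_cases ha : f a = j
      · exact Or.inr ⟨h1, ha⟩
      · exact Or.inl ⟨h1, by omega⟩
    · rintro (⟨h1, h2⟩ | ⟨h1, h2⟩)
      · exact ⟨h1, by omega⟩
      · exact ⟨h1, by omega⟩
  have hdisj : Disjoint (univ.filter (fun a => a ≤ i ∧ j1 ≤ f a))
      (univ.filter (fun a => a ≤ i ∧ f a = j)) := by
    rw [disjoint_filter]
    intro a _ h1 h2
    omega
  rw [hsplit, card_union_of_disjoint hdisj]

/-- An injective `p` takes the value `j` at most once among the rows `≤ i`. -/
theorem card_row_eq_le_one (f : Equiv.Perm (Fin n)) (i j : Fin n) :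
    (univ.filter (fun a => a ≤ i ∧ f a = j)).card ≤ 1 := by
  rw [card_le_one]
  intro a ha b hb
  simp only [mem_filter, mem_univ, true_and] at ha hb
  exact f.injective (ha.2.trans hb.2.symm)

/-- If no row `≤ i` carries the value `j`, the count is `0`. -/
theorem card_row_eq_zero (f : Fin n → Fin n) (i j : Fin n) (h : ∀ a, a ≤ i → f a ≠ j) :
    (univ.filter (fun a => a ≤ i ∧ f a = j)).card = 0 := by
  rw [card_eq_zero, filter_eq_empty_iff]
  intro a _ h'
  exact h a h'.1 h'.2

/-- If some row `a₀ ≤ i` carries the value `j` (and `p` is injective), the count is `1`. -/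
theorem card_row_eq_one (f : Equiv.Perm (Fin n)) (i j a₀ : Fin n) (h₀ : a₀ ≤ i)
    (h₀v : f a₀ = j) : (univ.filter (fun a => a ≤ i ∧ f a = j)).card = 1 := by
  apply le_antisymm (card_row_eq_le_one f i j)
  exact card_pos.mpr ⟨a₀, by simp [h₀, h₀v]⟩

/-- The complementary south-west count: `#{a > I : p a < J} + (I + 1) = J + p[I, J]` for a
permutation `p` (both sides count `#{a : p a < J} + p[I,J] = #{a ≤ I} + #{a > I : p a < J}`). -/
theorem sw_count (f : Equiv.Perm (Fin n)) (I J : Fin n) :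
    (univ.filter (fun a => I < a ∧ f a < J)).card + ((I : ℕ) + 1) =
      (J : ℕ) + (univ.filter (fun a => a ≤ I ∧ J ≤ f a)).card := by
  have h1 := card_filter_split univ (fun a => f a < J) (fun a => a ≤ I)
  have h2 := card_filter_split univ (fun a : Fin n => a ≤ I) (fun a => f a < J)
  rw [card_filter_lt_perm] at h1
  rw [card_filter_le_row] at h2
  have e1 : (univ.filter (fun a => f a < J ∧ a ≤ I)).card =
      (univ.filter (fun a => a ≤ I ∧ f a < J)).card := by
    congr 1; ext a; simp only [mem_filter, mem_univ, true_and]; tauto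
  have e2 : (univ.filter (fun a => f a < J ∧ ¬ a ≤ I)).card =
      (univ.filter (fun a => I < a ∧ f a < J)).card := by
    congr 1; ext a; simp only [mem_filter, mem_univ, true_and, not_le]; tauto
  have e3 : (univ.filter (fun a => a ≤ I ∧ ¬ f a < J)).card =
      (univ.filter (fun a => a ≤ I ∧ J ≤ f a)).card := by
    congr 1; ext a; simp only [mem_filter, mem_univ, true_and, not_lt]
  omega

/-! ## The easy direction: `σ ≤ w` puts every rook of `σ` in the right hull of `w` -/

/-- If `σ ≤ w` in the rank criterion then every rook `(a, σ a)` has a rook of `w` weakly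
north-east of it. -/
theorem ne_witness (w σ : Equiv.Perm (Fin n))
    (hle : ∀ i j : Fin n, (univ.filter (fun a => a ≤ i ∧ j ≤ σ a)).card ≤
      (univ.filter (fun a => a ≤ i ∧ j ≤ w a)).card) (a : Fin n) :
    ∃ a', a' ≤ a ∧ σ a ≤ w a' := by
  have hpos : 0 < (univ.filter (fun a' => a' ≤ a ∧ σ a ≤ σ a')).card :=
    card_pos.mpr ⟨a, by simp⟩
  have hle' := hle a (σ a)
  obtain ⟨a', ha'⟩ := card_pos.mp (by omega :
    0 < (univ.filter (fun a' => a' ≤ a ∧ σ a ≤ w a')).card)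
  simp only [mem_filter, mem_univ, true_and] at ha'
  exact ⟨a', ha'.1, ha'.2⟩

/-- If `σ ≤ w` in the rank criterion then every rook `(a, σ a)` has a rook of `w` weakly
south-west of it (the rank criterion is self-dual under the 180° rotation; we argue directly with
the complementary count `sw_count` at the square `(a-1, σ a + 1)`). -/
theorem sw_witness (w σ : Equiv.Perm (Fin n))
    (hle : ∀ i j : Fin n, (univ.filter (fun a => a ≤ i ∧ j ≤ σ a)).card ≤
      (univ.filter (fun a => a ≤ i ∧ j ≤ w a)).card) (a : Fin n) :
    ∃ a', a ≤ a' ∧ w a' ≤ σ a := by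
  by_contra hcon
  push Not at hcon
  -- the rook of `w` in column `σ a` is then strictly above row `a`, so `a ≥ 1`
  have ht : w.symm (σ a) < a := by
    by_contra h
    have := hcon (w.symm (σ a)) (not_lt.mp h)
    simp at this
  have ha1 : 1 ≤ (a : ℕ) := by
    have : (0 : ℕ) ≤ (w.symm (σ a) : ℕ) := Nat.zero_le _
    omega
  -- and `σ a + 1 < n` since `w a > σ a`
  have hb : (σ a : ℕ) + 1 < n := by
    have := hcon a le_rfl
    omega
  obtain ⟨i, hi⟩ : ∃ i : Fin n, (i : ℕ) + 1 = a := ⟨⟨(a : ℕ) - 1, by omega⟩, by simp; omega⟩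
  obtain ⟨j, hj⟩ : ∃ j : Fin n, (j : ℕ) = σ a + 1 := ⟨⟨(σ a : ℕ) + 1, hb⟩, rfl⟩
  have e1 := sw_count w i j
  have e2 := sw_count σ i j
  have hle' := hle i j
  have hw0 : (univ.filter (fun a' => i < a' ∧ w a' < j)).card = 0 := by
    rw [card_eq_zero, filter_eq_empty_iff]
    rintro a' - ⟨h1, h2⟩
    have := hcon a' (by omega)
    omega
  have hσ1 : 0 < (univ.filter (fun a' => i < a' ∧ σ a' < j)).card :=
    card_pos.mpr ⟨a, by simp only [mem_filter, mem_univ, true_and]; omega⟩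
  omega

end Summit.ValiantsHypothesis.ValiantsHypothesis.Theorems.PartialSortingSmoothIsBoardRank
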